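import Summits.QuantumFields.QCD.Theorems.GaussianLinkFramesFrameFMClosurePlacementSidesAux8

/-!
# Crux `GaussianLinkFrames.FrameFMClosure` (stmt-QuantumFields-17375), line `pad-the-fibre`, stub
`stub_placementSides` — helper 9: antipodal configurations of the thinnest box complement, both points off the
antipode and at least one of them with a coordinate at distance `≥ 2` from its antipodal residue

With `q j = z j + S` and the residual hypothesis `∀ j, a j = q j ∨ b j = q j`, a coordinate where a point sits at
distance `≥ 2` from `q j` receives a defect triple centred so that the point's block is TRACE-FREE there (`big_rule`):
at distance `2, 3` the triple is centred at `q j ∓ 1`, at distance `≥ 4` at `q j`.  If both points have such a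
coordinate both blocks are trace-free and the far flip alone pairs them (`rsA1`); if only `a` has one, the small point
`b ≠ o` is made SAFE — its `±1`-coordinate `i` traces only `q i`, and an antipodal coordinate `k` of `b` traces a
domino (`rsA2`).  The engine of helper 8 concludes.

References: elementary [folklore]; the pad recipe is the line card of `pad-the-fibre`.
-/

noncomputable section

open scoped BigOperators
open Literature.MathematicalPhysics.QuantumFieldTheory Literature.MathematicalPhysics.QuantumLattice
  Literature.Probability.LatticeModels
open Summit.QuantumFields.QCD.Theorems.VonMisesCircles Summit.QuantumFields.QCD.Theorems.PadTheFibre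

namespace Summit.QuantumFields.QCD.Theorems.PadTheFibreTwoStar

/-! ## §1 Small offset facts -/

/-- Reading a residue off its offset: `(u - p).val = k` iff `u = p + k` (`k < N`). [folklore] -/
theorem val_sub_eq_iff {N : ℕ} [NeZero N] (u p : ZMod N) (k : ℕ) (hk : k < N) :
    (u - p).val = k ↔ u = p + (k : ZMod N) := by
  constructor
  · intro h
    have : ((u - p).val : ZMod N) = (k : ZMod N) := by rw [h]
    rw [ZMod.natCast_zmod_val] at this
    linear_combination this
  · intro h
    rw [h, add_sub_cancel_left, ZMod.val_cast_of_lt hk]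

/-- **The triple rule for a coordinate at distance `≥ 2` from the antipodal residue.**  For `2 ≤ (c - q).val ≤ N-2`
the base `p = q + 1` (distance `2, 3` above), `q + 3` (distance `2, 3` below) or `q + 2` (otherwise) has `c` at an
offset in `[1, N-5]` (trace-free block) and `q` in its triple. [folklore] -/
theorem big_rule {N : ℕ} [NeZero N] (hN : 9 ≤ N) (q c : ZMod N) (h : 2 ≤ (c - q).val ∧ (c - q).val ≤ N - 2) :
    let p : ZMod N := if (c - q).val ≤ 3 then q + 1 else if N - 3 ≤ (c - q).val then q + 3 else q + 2
    1 ≤ (c - p).val ∧ (c - p).val ≤ N - 5 ∧ N - 3 ≤ (q - p).val := by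
  intro p
  have hq : ∀ m : ℕ, 1 ≤ m → m ≤ 3 → (q - (q + (m : ZMod N))).val = N - m := by
    intro m h1 h3
    rw [show q - (q + (m : ZMod N)) = -(m : ZMod N) by ring, ZMod.neg_val, if_neg, ZMod.val_cast_of_lt (by omega)]
    intro h0; rw [ZMod.natCast_eq_zero_iff] at h0; have := Nat.le_of_dvd (by omega) h0; omega
  have hc : ∀ m : ℕ, m ≤ (c - q).val → (c - (q + (m : ZMod N))).val = (c - q).val - m := by
    intro m hm
    rw [show c - (q + (m : ZMod N)) = (c - q) - (m : ZMod N) by ring, val_sub_natCast_of_le _ m hm]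
  by_cases h3 : (c - q).val ≤ 3
  · have hp : p = q + ((1 : ℕ) : ZMod N) := by simp only [p, if_pos h3]; push_cast; ring
    rw [hp, hq 1 le_rfl (by omega), hc 1 (by omega)]; omega
  by_cases h4 : N - 3 ≤ (c - q).val
  · have hp : p = q + ((3 : ℕ) : ZMod N) := by simp only [p, if_neg h3, if_pos h4]; push_cast; ring
    rw [hp, hq 3 (by omega) le_rfl, hc 3 (by omega)]; omega
  · have hp : p = q + ((2 : ℕ) : ZMod N) := by simp only [p, if_neg h3, if_neg h4]; push_cast; ring
    rw [hp, hq 2 (by omega) (by omega), hc 2 (by omega)]; omega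

/-- Offsets of `q`, `q + 1`, `q - 1` from the three admissible bases `q + 1`, `q + 2`, `q + 3`. [folklore] -/
theorem q_offsets {N : ℕ} [NeZero N] (hN : 9 ≤ N) (q : ZMod N) (m : ℕ) (hm1 : 1 ≤ m) (hm3 : m ≤ 3) :
    (q - (q + (m : ZMod N))).val = N - m ∧ (m = 1 → (q + 1 - (q + (m : ZMod N))).val = 0) ∧
      (2 ≤ m → (q + 1 - (q + (m : ZMod N))).val = N + 1 - m) ∧ (q - 1 - (q + (m : ZMod N))).val = N - 1 - m := by
  have hneg : ∀ j : ℕ, 1 ≤ j → j ≤ 4 → (-(j : ZMod N)).val = N - j := by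
    intro j h1 h4
    rw [ZMod.neg_val, if_neg, ZMod.val_cast_of_lt (by omega)]
    intro h0; rw [ZMod.natCast_eq_zero_iff] at h0; have := Nat.le_of_dvd (by omega) h0; omega
  refine ⟨by rw [show q - (q + (m : ZMod N)) = -(m : ZMod N) by ring]; exact hneg m hm1 (by omega), ?_, ?_, ?_⟩
  · rintro rfl
    rw [show q + 1 - (q + ((1 : ℕ) : ZMod N)) = ((0 : ℕ) : ZMod N) by push_cast; ring, ZMod.val_cast_of_lt (by omega)]
  · intro h2
    rw [show q + 1 - (q + (m : ZMod N)) = -(((m - 1 : ℕ)) : ZMod N) by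
      rw [Nat.cast_sub (by omega)]; push_cast; ring]
    rw [hneg (m - 1) (by omega) (by omega)]; omega
  · rw [show q - 1 - (q + (m : ZMod N)) = -(((m + 1 : ℕ)) : ZMod N) by push_cast; ring]
    rw [hneg (m + 1) (by omega) (by omega)]; omega

/-! ## §2 High offsets -/

/-- The residues at offsets `N - i` (`1 ≤ i ≤ 3`) from `p` are `p - i`. [folklore] -/
theorem off_high {N : ℕ} [NeZero N] (hN : 9 ≤ N) (p u : ZMod N) (i : ℕ) (hi1 : 1 ≤ i) (hi3 : i ≤ 3) :
    (u - p).val = N - i ↔ u = p - (i : ZMod N) := by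
  rw [val_sub_eq_iff u p (N - i) (by omega), Nat.cast_sub (by omega), ZMod.natCast_self, zero_sub]
  constructor <;> intro h <;> rw [h] <;> ring

/-- A window of high offsets `[N - i, N - i']` lists the residues `p - i, …, p - i'`. [folklore] -/
theorem high_window {N : ℕ} [NeZero N] (hN : 9 ≤ N) (p u : ZMod N) :
    ((N - 1 ≤ (u - p).val ∧ (u - p).val ≤ N - 1) ↔ u = p - 1) ∧
    ((N - 3 ≤ (u - p).val ∧ (u - p).val ≤ N - 3) ↔ u = p - 3) ∧
    ((N - 2 ≤ (u - p).val ∧ (u - p).val ≤ N - 1) ↔ (u = p - 2 ∨ u = p - 2 + 1)) ∧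
    ((N - 3 ≤ (u - p).val ∧ (u - p).val ≤ N - 2) ↔ (u = p - 3 ∨ u = p - 3 + 1)) := by
  have hul : (u - p).val < N := ZMod.val_lt _
  have h1 := off_high hN p u 1 le_rfl (by omega)
  have h2 := off_high hN p u 2 (by omega) (by omega)
  have h3 := off_high hN p u 3 (by omega) le_rfl
  push_cast at h1 h2 h3
  refine ⟨?_, ?_, ?_, ?_⟩
  · rw [← h1]; omega
  · rw [← h3]; omega
  · rw [show p - 2 + 1 = p - 1 by ring, ← h2, ← h1]; omega
  · rw [show p - 3 + 1 = p - 2 by ring, ← h3, ← h2]; omega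

/-! ## §3 Both points have a coordinate at distance `≥ 2` from the antipode -/

open Classical in
/-- **Antipodal configuration, both points big** (`4 ≤ S`, `r = S - 1`): if `∀ j, a j = q j ∨ b j = q j` and both `a`
and `b` have a coordinate at distance `≥ 2` from its antipodal residue, a balanced canonical placement exists (both
blocks trace-free, far flip). [folklore] -/
theorem rsA1 {S : ℕ} (hS : 4 ≤ S) (z a b : TorusSite 4 (2 * S + 1))
    (hres : ∀ j, a j = z j + (S : ZMod (2 * S + 1)) ∨ b j = z j + (S : ZMod (2 * S + 1)))
    (hA : ∃ j, 2 ≤ (a j - (z j + (S : ZMod (2 * S + 1)))).val ∧ (a j - (z j + (S : ZMod (2 * S + 1)))).val ≤ 2 * S + 1 - 2)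
    (hB : ∃ j, 2 ≤ (b j - (z j + (S : ZMod (2 * S + 1)))).val ∧ (b j - (z j + (S : ZMod (2 * S + 1)))).val ≤ 2 * S + 1 - 2) :
    ∃ (x' y' : TorusSite 4 (2 * S + 1)) (Q₁ Q₂ : Finset (Edge 4 (2 * S + 1))),
      a ∈ ebox S x' 0 ∧ b ∈ ebox S y' 0 ∧ IsPadRegion S x' Q₁ ∧ IsPadRegion S y' Q₂ ∧
      Q₁ ⊆ padLinks S x' ∧ Q₂ ⊆ padLinks S y' ∧
      Balanced (touched S (ebox S z (S - 1))ᶜ (starLinks S a ∪ starLinks S b ∪ Q₁ ∪ Q₂)) := by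
  haveI : NeZero (2 * S + 1) := ⟨by omega⟩
  have hN9 : 9 ≤ 2 * S + 1 := by omega
  set q : Fin 4 → ZMod (2 * S + 1) := fun j => z j + (S : ZMod (2 * S + 1)) with hqd
  -- the triple rule per coordinate: governed by the big point there (at most one, by `hres`)
  set rule : ZMod (2 * S + 1) → ZMod (2 * S + 1) → ZMod (2 * S + 1) := fun qq c =>
    if (c - qq).val ≤ 3 then qq + 1 else if 2 * S + 1 - 3 ≤ (c - qq).val then qq + 3 else qq + 2 with hrule
  set p : Fin 4 → ZMod (2 * S + 1) := fun j =>
    if 2 ≤ (a j - q j).val ∧ (a j - q j).val ≤ 2 * S + 1 - 2 then rule (q j) (a j) else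
    if 2 ≤ (b j - q j).val ∧ (b j - q j).val ≤ 2 * S + 1 - 2 then rule (q j) (b j) else q j + 2 with hp
  have hrule : ∀ (qq c : ZMod (2 * S + 1)), 2 ≤ (c - qq).val ∧ (c - qq).val ≤ 2 * S + 1 - 2 →
      1 ≤ (c - rule qq c).val ∧ (c - rule qq c).val ≤ 2 * S + 1 - 5 ∧ 2 * S + 1 - 3 ≤ (qq - rule qq c).val :=
    fun qq c h => big_rule hN9 qq c h
  have hq : ∀ i, 2 * S + 1 - 3 ≤ (q i - p i).val := by
    intro i
    simp only [hp]
    split_ifs with h1 h2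
    · exact (hrule _ _ h1).2.2
    · exact (hrule _ _ h2).2.2
    · have := (q_offsets hN9 (q i) 2 (by omega) (by omega)).1
      rw [show (q i + ((2 : ℕ) : ZMod (2 * S + 1))) = q i + 2 by push_cast; ring] at this
      omega
  -- pad data
  have hDa := fun j => tstar_coord_data (N := 2 * S + 1) hN9 ⟨S, by omega⟩ (p j) (a j) false false
  have hDb := fun j => tstar_coord_data (N := 2 * S + 1) hN9 ⟨S, by omega⟩ (p j) (b j) false false
  choose Ba fa ca k₁a k₂a j₁a j₂a hcva hcorea hfara hk₁a hk₂a hk₂Na hj₁a hj₂a hwina hA2 hA1 hA0 hA4 hA3 hAe hABa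
    hABp hAB0 hAB1 hAC1 hAC2 hAC3 using hDa
  choose Bb fb cb k₁b k₂b j₁b j₂b hcvb hcoreb hfarb hk₁b hk₂b hk₂Nb hj₁b hj₂b hwinb hB2 hB1 hB0 hB4 hB3 hBe hBBa
    hBBp hBB0 hBB1 hBC1 hBC2 hBC3 using hDb
  obtain ⟨ja, hja⟩ := hA
  obtain ⟨jb, hjb⟩ := hB
  -- the strategies: trace-free coordinates
  have hpa : p ja = rule (q ja) (a ja) := by simp only [hp]; rw [if_pos hja]
  have hpb : p jb = rule (q jb) (b jb) := by
    have hajb : a jb = q jb := by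
      rcases hres jb with h | h
      · exact h
      · exfalso; rw [h, sub_self, ZMod.val_zero] at hjb; omega
    simp only [hp]
    rw [if_neg (by rw [hajb, sub_self, ZMod.val_zero]; omega), if_pos hjb]
  have hsa : j₂a ja < j₁a ja := hAe ja (by rw [hpa]; exact ⟨(hrule _ _ hja).1, (hrule _ _ hja).2.1⟩)
  have hsb : j₂b jb < j₁b jb := hBe jb (by rw [hpb]; exact ⟨(hrule _ _ hjb).1, (hrule _ _ hjb).2.1⟩)
  exact rs_blocks_balanced hS z p hq a b Ba Bb fa fb ca cb k₁a k₂a j₁a j₂a k₁b k₂b j₁b j₂b hcva hcvb hcorea hcoreb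
    hfara hfarb (fun j => ⟨hk₁a j, hk₂a j, hk₂Na j, hj₁a j⟩) (fun j => ⟨hk₁b j, hk₂b j, hk₂Nb j, hj₁b j⟩)
    hwina hwinb 0 0 0 0 (Or.inl ⟨ja, hsa⟩) (Or.inl ⟨jb, hsb⟩)

/-- **Registered helper `stub_placementSides_aux9` of crux stmt-QuantumFields-17375** (line `pad-the-fibre`, stub
`stub_placementSides`): antipodal configuration of the thinnest box complement with both points big: balanced placement by the far flip. [folklore] -/
theorem stub_placementSides_aux9 : ∀ (S : ℕ), 4 ≤ S → ∀ (z a b : TorusSite 4 (2 * S + 1)), (∀ j, a j = z j + (S : ZMod (2 * S + 1)) ∨ b j = z j + (S : ZMod (2 * S + 1))) → (∃ j, 2 ≤ (a j - (z j + (S : ZMod (2 * S + 1)))).val ∧ (a j - (z j + (S : ZMod (2 * S + 1)))).val ≤ 2 * S + 1 - 2) → (∃ j, 2 ≤ (b j - (z j + (S : ZMod (2 * S + 1)))).val ∧ (b j - (z j + (S : ZMod (2 * S + 1)))).val ≤ 2 * S + 1 - 2) → ∃ (x' y' : TorusSite 4 (2 * S + 1)) (Q₁ Q₂ : Finset (Edge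 4 (2 * S + 1))), a ∈ ebox S x' 0 ∧ b ∈ ebox S y' 0 ∧ IsPadRegion S x' Q₁ ∧ IsPadRegion S y' Q₂ ∧ Q₁ ⊆ padLinks S x' ∧ Q₂ ⊆ padLinks S y' ∧ Balanced (touched S (ebox S z (S - 1))ᶜ (starLinks S a ∪ starLinks S b ∪ Q₁ ∪ Q₂)) :=
  fun _ hS z a b hres hA hB => rsA1 hS z a b hres hA hB

end Summit.QuantumFields.QCD.Theorems.PadTheFibreTwoStar

end
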